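import Mathlib
import Literature.Analysis.FluidPDE.Tao2016AveragedNS.RenormalisedCascadeWaves
import Literature.Analysis.FluidPDE.Tao2016AveragedNS.BoundedEternalSolutions
import Summits.NavierStokesRegularity.NavierStokesRegularity.Theorems.TaoLadderRungTwoBreakNoSurvivingEternalViscBddOneWakeDyadicAncientApriori

/-!
# Crux `TaoLadderRungTwoBreak.NoSurvivingEternalViscBddOne` (stmt-NavierStokesRegularity-20419), stub (ρ0), DYADIC MEMBER in
# classical form: the CRITICAL SQUARING STEP shell → shell and the terminal ratio through the critical amplitude

MODEL lattice ODEs only (Tao 2016 §1.2/§4, critical variables of §6.4); nothing here is a statement about the Navier–Stokes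
equations; no stub, crux, rung or summit is proved (`--supports stmt-NavierStokesRegularity-20419`).  Route-independent, DEF-FREE,
classical real analysis on the objects of the tree's `dyadic_noSurviving_iff_classicalPos` (the positive type-I classical form of
(ρ0)|dyadic = W1-dyadic of the census): real shells `V_n ≥ 0`, `n ∈ ℤ`, on `t < 0` with
`V̇_n = Λ V_{n-1}² − Λ⁻¹ V_n V_{n+1}`, type I `V_n(t) ≤ C/(-t)`, action `∫_{(-∞,0)} V_n ≤ M`, `V_n(t) → v_n` (`t ↑ 0`).
The scale-critical amplitude of shell `n` is `c_n = sup_{t<0} (-t)·V_n(t)` (`= sup_σ W_n(σ)`, the renormalised amplitude).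

* `succ_le_add_crit`, `crit_succ_le_sq` — **THE SQUARING STEP**: `(-t)·V_n ≤ c` for all `t < 0` ⟹ `(-t)·V_{n+1} ≤ Λc²` for all
  `t < 0` (integrate `V̇_{n+1} ≤ ΛV_n² ≤ Λc²/t²` from `-∞`, where `V_{n+1} → 0` by type I: the fence `V_{n+1}(u) + Λc²/u` is
  antitone).  Uses ONLY the law, positivity and the type-I decay at `-∞` — the shell-wise form of the squaring step behind the
  tree's GLOBAL small-amplitude Liouville theorem (`…SmallAmplitudeRung`: `sup_{n,σ}‖W‖ < 1/K ⇒ W ≡ 0`).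
* `crit_iterate_le` — `(-t)·V_{n+j} ≤ Λ⁻¹(Λc)^{2^j}`: above ONE shell with `Λ c_n < 1` the critical amplitudes decay
  DOUBLE-EXPONENTIALLY.
* `succ_le_add_ceiling`, `terminal_succ_le_window`, `terminal_succ_le_crit` — `v_{n+1} ≤ Λc_n²/(-τ) + ΛK_n²(-τ)` for every `τ < 0`
  (`K_n = e^{M/Λ}v_n`, the no-overshoot ceiling of the tree's `…WakeDyadicAncientApriori.noOvershoot`), whence
  **`v_{n+1} ≤ 2Λ c_n e^{M/Λ} · v_n`** — companion of the tree's action form `v_{n+1} ≤ ΛMe^{M/Λ}v_n` (`terminal_succ_le`).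

Sequel (`…WakeDyadicCriticalFloor`): sterilisation above a sub-critical shell and the survivor's per-shell floor `c_n ≥ Λ⁻¹`.
HONEST LABEL: elementary a-priori estimates (monotonicity of explicit fences); (ρ0), ⟨20419⟩ and every NS statement remain OPEN.
-/

noncomputable section

namespace Summit.NavierStokesRegularity.NavierStokesRegularity.Theorems.NoSurvivingEternalViscBddOne.DyadicCriticalSquaring

open Filter Topology Set MeasureTheory intervalIntegral
open Literature.Analysis.FluidPDE Literature.Analysis.FluidPDE.TaoCascade
open Summit.NavierStokesRegularity.NavierStokesRegularity.Theorems.NoSurvivingEternalViscBddOne.DyadicAncient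

variable {ε₀ : ℝ} {V : ℤ → ℝ → ℝ}

/-! ## The squaring step -/

/-- **Two-time form of the squaring step.**  If `(-u)·V_n(u) ≤ c` for all `u < 0`, then for `t₀ ≤ t < 0`:
`V_{n+1}(t) ≤ V_{n+1}(t₀) + Λc²/(-t)` — the fence `u ↦ V_{n+1}(u) + Λc²/u` is antitone on `[t₀, t]`
(`V̇_{n+1} ≤ ΛV_n² ≤ Λc²/u²`, the drain is non-negative).
[cite: Tao2016AveragedNS, §1.2 (the scalar energy-transfer chain), §4 Lemma 4.1 (4.8), §6.4; elementary] -/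
theorem succ_le_add_crit (hε : 0 < ε₀)
    (hV : ∀ (n : ℤ) (t : ℝ), t < 0 →
      HasDerivAt (V n) (bigLam ε₀ * V (n - 1) t ^ 2 - (bigLam ε₀)⁻¹ * (V n t * V (n + 1) t)) t)
    (hpos : ∀ (n : ℤ) (t : ℝ), t < 0 → 0 ≤ V n t)
    (n : ℤ) {c : ℝ} (hc : ∀ t : ℝ, t < 0 → (-t) * V n t ≤ c)
    {t₀ t : ℝ} (ht₀ : t₀ ≤ t) (ht : t < 0) :
    V (n + 1) t ≤ V (n + 1) t₀ + bigLam ε₀ * c ^ 2 / (-t) := by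
  have hΛ : 0 < bigLam ε₀ := bigLam_pos (by linarith)
  have ht₀0 : t₀ < 0 := lt_of_le_of_lt ht₀ ht
  set g : ℝ → ℝ := fun u => V (n + 1) u + bigLam ε₀ * c ^ 2 * u⁻¹ with hg
  have hderiv : ∀ u, u < 0 → HasDerivAt g
      (bigLam ε₀ * V (n + 1 - 1) u ^ 2 - (bigLam ε₀)⁻¹ * (V (n + 1) u * V (n + 1 + 1) u)
        + bigLam ε₀ * c ^ 2 * (-(u ^ 2)⁻¹)) u := by
    intro u hu
    exact (hV (n + 1) u hu).add ((hasDerivAt_inv hu.ne).const_mul _)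
  have hanti : AntitoneOn g (Icc t₀ t) := by
    refine antitoneOn_of_hasDerivWithinAt_nonpos (convex_Icc t₀ t) ?_ ?_ ?_ (f' := fun u =>
      bigLam ε₀ * V (n + 1 - 1) u ^ 2 - (bigLam ε₀)⁻¹ * (V (n + 1) u * V (n + 1 + 1) u)
        + bigLam ε₀ * c ^ 2 * (-(u ^ 2)⁻¹))
    · intro u hu
      exact (hderiv u (lt_of_le_of_lt hu.2 ht)).continuousAt.continuousWithinAt
    · intro u hu
      rw [interior_Icc] at hu
      exact (hderiv u (hu.2.trans ht)).hasDerivWithinAt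
    · intro u hu
      rw [interior_Icc] at hu
      have hu0 : u < 0 := hu.2.trans ht
      have hnu : 0 < -u := by linarith
      have h1 : V (n + 1 - 1) u = V n u := by rw [add_sub_cancel_right]
      rw [h1]
      have hVn : 0 ≤ V n u := hpos n u hu0
      have hcu : (-u) * V n u ≤ c := hc u hu0
      have hdrain : 0 ≤ (bigLam ε₀)⁻¹ * (V (n + 1) u * V (n + 1 + 1) u) := by
        have := hpos (n + 1) u hu0
        have := hpos (n + 1 + 1) u hu0
        positivity
      have h2 : V n u ≤ c / (-u) := by
        rw [le_div_iff₀ hnu, mul_comm]; exact hcu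
      have hsq : V n u ^ 2 ≤ c ^ 2 * (u ^ 2)⁻¹ := by
        have h3 : V n u ^ 2 ≤ (c / (-u)) ^ 2 := pow_le_pow_left₀ hVn h2 2
        calc V n u ^ 2 ≤ (c / (-u)) ^ 2 := h3
          _ = c ^ 2 * (u ^ 2)⁻¹ := by rw [div_pow, neg_sq, div_eq_mul_inv]
      have h4 : bigLam ε₀ * V n u ^ 2 ≤ bigLam ε₀ * (c ^ 2 * (u ^ 2)⁻¹) :=
        mul_le_mul_of_nonneg_left hsq hΛ.le
      have e : bigLam ε₀ * c ^ 2 * (-(u ^ 2)⁻¹) = -(bigLam ε₀ * (c ^ 2 * (u ^ 2)⁻¹)) := by ring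
      rw [e]
      linarith
  have hmono : g t ≤ g t₀ := hanti (left_mem_Icc.2 ht₀) (right_mem_Icc.2 ht₀) ht₀
  have hmono' : V (n + 1) t + bigLam ε₀ * c ^ 2 * t⁻¹ ≤ V (n + 1) t₀ + bigLam ε₀ * c ^ 2 * t₀⁻¹ :=
    hmono
  have hneg : bigLam ε₀ * c ^ 2 * t₀⁻¹ ≤ 0 := by
    have hi : t₀⁻¹ < 0 := inv_lt_zero.mpr ht₀0
    have hc2 : 0 ≤ bigLam ε₀ * c ^ 2 := by positivity
    nlinarith
  have hid : bigLam ε₀ * c ^ 2 / (-t) = -(bigLam ε₀ * c ^ 2 * t⁻¹) := by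
    rw [div_neg, div_eq_mul_inv]
  rw [hid]
  linarith

/-- **THE CRITICAL SQUARING STEP.**  For a non-negative type-I solution of (KP-crit) on `t < 0`: if `(-t)·V_n(t) ≤ c` for all
`t < 0`, then `(-t)·V_{n+1}(t) ≤ Λ c²` for all `t < 0` (let `t₀ → -∞` in `succ_le_add_crit`; `V_{n+1}(t₀) ≤ C/(-t₀) → 0`).
In renormalised amplitude: `sup_σ W_{n+1} ≤ Λ (sup_σ W_n)²`.  No action bound and no terminal value is used.
[cite: Tao2016AveragedNS, §1.2, §4 Lemma 4.1 (4.8), §6.4; elementary] -/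
theorem crit_succ_le_sq (hε : 0 < ε₀)
    (hV : ∀ (n : ℤ) (t : ℝ), t < 0 →
      HasDerivAt (V n) (bigLam ε₀ * V (n - 1) t ^ 2 - (bigLam ε₀)⁻¹ * (V n t * V (n + 1) t)) t)
    (hpos : ∀ (n : ℤ) (t : ℝ), t < 0 → 0 ≤ V n t)
    (hI : ∃ C : ℝ, ∀ (n : ℤ) (t : ℝ), t < 0 → V n t ≤ C / (-t))
    (n : ℤ) {c : ℝ} (hc : ∀ t : ℝ, t < 0 → (-t) * V n t ≤ c) :
    ∀ t : ℝ, t < 0 → (-t) * V (n + 1) t ≤ bigLam ε₀ * c ^ 2 := by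
  have hΛ : 0 < bigLam ε₀ := bigLam_pos (by linarith)
  obtain ⟨C, hC⟩ := hI
  intro t ht
  have hnt : 0 < -t := by linarith
  have hmain : V (n + 1) t ≤ bigLam ε₀ * c ^ 2 / (-t) := by
    refine le_of_forall_pos_lt_add fun δ hδ => ?_
    set t₀ : ℝ := min t (-(|C| / δ + 1)) with ht₀def
    have ht₀t : t₀ ≤ t := min_le_left _ _
    have ht₀2 : t₀ ≤ -(|C| / δ + 1) := min_le_right _ _
    have ht₀neg : 0 < -t₀ := by
      have : 0 ≤ |C| / δ := by positivity
      linarith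
    have hCt : C / (-t₀) < δ := by
      rw [div_lt_iff₀ ht₀neg]
      have h1 : |C| / δ + 1 ≤ -t₀ := by linarith
      have h2 : |C| < δ * (|C| / δ + 1) := by
        rw [mul_add, mul_div_cancel₀ _ hδ.ne', mul_one]; linarith
      calc C ≤ |C| := le_abs_self C
        _ < δ * (|C| / δ + 1) := h2
        _ ≤ δ * (-t₀) := mul_le_mul_of_nonneg_left h1 hδ.le
    have h := succ_le_add_crit hε hV hpos n hc ht₀t ht
    have hVt₀ : V (n + 1) t₀ ≤ C / (-t₀) := hC (n + 1) t₀ (by linarith)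
    linarith
  calc (-t) * V (n + 1) t ≤ (-t) * (bigLam ε₀ * c ^ 2 / (-t)) := mul_le_mul_of_nonneg_left hmain hnt.le
    _ = bigLam ε₀ * c ^ 2 := mul_div_cancel₀ _ hnt.ne'

/-- **Double-exponential decay above a shell.**  If `(-t)·V_n(t) ≤ c` for all `t < 0`, then for every `j ≥ 0` and `t < 0`:
`(-t)·V_{n+j}(t) ≤ Λ⁻¹ (Λc)^{2^j}` (iterate `crit_succ_le_sq`: `c ↦ Λc²` is `Λc ↦ (Λc)²`).
[cite: Tao2016AveragedNS, §1.2, §4 Lemma 4.1 (4.8), §6.4; elementary] -/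
theorem crit_iterate_le (hε : 0 < ε₀)
    (hV : ∀ (n : ℤ) (t : ℝ), t < 0 →
      HasDerivAt (V n) (bigLam ε₀ * V (n - 1) t ^ 2 - (bigLam ε₀)⁻¹ * (V n t * V (n + 1) t)) t)
    (hpos : ∀ (n : ℤ) (t : ℝ), t < 0 → 0 ≤ V n t)
    (hI : ∃ C : ℝ, ∀ (n : ℤ) (t : ℝ), t < 0 → V n t ≤ C / (-t))
    (n : ℤ) {c : ℝ} (hc : ∀ t : ℝ, t < 0 → (-t) * V n t ≤ c) (j : ℕ) :
    ∀ t : ℝ, t < 0 → (-t) * V (n + j) t ≤ (bigLam ε₀)⁻¹ * (bigLam ε₀ * c) ^ (2 ^ j) := by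
  have hΛ : 0 < bigLam ε₀ := bigLam_pos (by linarith)
  induction j with
  | zero =>
    intro t ht
    simp only [Nat.cast_zero, add_zero, pow_zero, pow_one]
    rw [inv_mul_cancel_left₀ hΛ.ne']
    exact hc t ht
  | succ k ih =>
    intro t ht
    have h := crit_succ_le_sq hε hV hpos hI (n + k) ih t ht
    have e1 : (n : ℤ) + (k : ℕ) + 1 = n + ((k + 1 : ℕ) : ℤ) := by push_cast; ring
    rw [e1] at h
    calc (-t) * V (n + ((k + 1 : ℕ) : ℤ)) t
        ≤ bigLam ε₀ * ((bigLam ε₀)⁻¹ * (bigLam ε₀ * c) ^ (2 ^ k)) ^ 2 := h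
      _ = (bigLam ε₀)⁻¹ * ((bigLam ε₀ * c) ^ (2 ^ k)) ^ 2 := by field_simp
      _ = (bigLam ε₀)⁻¹ * (bigLam ε₀ * c) ^ (2 ^ (k + 1)) := by rw [← pow_mul, ← pow_succ]

/-! ## The terminal ratio through the critical amplitude -/

/-- **Two-time bound under a plain ceiling.**  If `0 ≤ V_n ≤ K` on `[τ, s]` (`s < 0`), then
`V_{n+1}(s) ≤ V_{n+1}(τ) + ΛK²(s − τ)` (the fence `u ↦ V_{n+1}(u) − ΛK²u` is antitone).
[cite: Tao2016AveragedNS, §1.2, §4 Lemma 4.1 (4.8), §6.4; elementary] -/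
theorem succ_le_add_ceiling (hε : 0 < ε₀)
    (hV : ∀ (n : ℤ) (t : ℝ), t < 0 →
      HasDerivAt (V n) (bigLam ε₀ * V (n - 1) t ^ 2 - (bigLam ε₀)⁻¹ * (V n t * V (n + 1) t)) t)
    (hpos : ∀ (n : ℤ) (t : ℝ), t < 0 → 0 ≤ V n t)
    (n : ℤ) {K τ s : ℝ} (hK : ∀ u : ℝ, τ ≤ u → u < 0 → V n u ≤ K) (hτs : τ ≤ s) (hs : s < 0) :
    V (n + 1) s ≤ V (n + 1) τ + bigLam ε₀ * K ^ 2 * (s - τ) := by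
  have hΛ : 0 < bigLam ε₀ := bigLam_pos (by linarith)
  set g : ℝ → ℝ := fun u => V (n + 1) u - bigLam ε₀ * K ^ 2 * u with hg
  have hderiv : ∀ u, u < 0 → HasDerivAt g
      (bigLam ε₀ * V (n + 1 - 1) u ^ 2 - (bigLam ε₀)⁻¹ * (V (n + 1) u * V (n + 1 + 1) u)
        - bigLam ε₀ * K ^ 2 * 1) u := by
    intro u hu
    exact (hV (n + 1) u hu).sub ((hasDerivAt_id u).const_mul _)
  have hanti : AntitoneOn g (Icc τ s) := by
    refine antitoneOn_of_hasDerivWithinAt_nonpos (convex_Icc τ s) ?_ ?_ ?_ (f' := fun u =>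
      bigLam ε₀ * V (n + 1 - 1) u ^ 2 - (bigLam ε₀)⁻¹ * (V (n + 1) u * V (n + 1 + 1) u)
        - bigLam ε₀ * K ^ 2 * 1)
    · intro u hu
      exact (hderiv u (lt_of_le_of_lt hu.2 hs)).continuousAt.continuousWithinAt
    · intro u hu
      rw [interior_Icc] at hu
      exact (hderiv u (hu.2.trans hs)).hasDerivWithinAt
    · intro u hu
      rw [interior_Icc] at hu
      have hu0 : u < 0 := hu.2.trans hs
      have h1 : V (n + 1 - 1) u = V n u := by rw [add_sub_cancel_right]
      rw [h1]
      have hVn : 0 ≤ V n u := hpos n u hu0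
      have hKu : V n u ≤ K := hK u hu.1.le hu0
      have hdrain : 0 ≤ (bigLam ε₀)⁻¹ * (V (n + 1) u * V (n + 1 + 1) u) := by
        have := hpos (n + 1) u hu0
        have := hpos (n + 1 + 1) u hu0
        positivity
      have hsq : V n u ^ 2 ≤ K ^ 2 := pow_le_pow_left₀ hVn hKu 2
      have h4 : bigLam ε₀ * V n u ^ 2 ≤ bigLam ε₀ * K ^ 2 := mul_le_mul_of_nonneg_left hsq hΛ.le
      linarith
  have hmono : g s ≤ g τ := hanti (left_mem_Icc.2 hτs) (right_mem_Icc.2 hτs) hτs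
  have hmono' : V (n + 1) s - bigLam ε₀ * K ^ 2 * s ≤ V (n + 1) τ - bigLam ε₀ * K ^ 2 * τ := hmono
  linarith

/-- **Window bound for the terminal value.**  With the critical amplitude `c` of shell `n` (`(-t)V_n(t) ≤ c`) and its
no-overshoot ceiling `K = e^{M/Λ} v_n` (tree `noOvershoot`): for EVERY `τ < 0`,
`v_{n+1} ≤ Λc²/(-τ) + ΛK²·(-τ)` (shell `n+1` is fed at most `Λc²/(-τ)` before `τ` and at most `ΛK²(-τ)` after).
[cite: Tao2016AveragedNS, §1.2, §4 Lemma 4.1 (4.8), §6.4; elementary] -/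
theorem terminal_succ_le_window (hε : 0 < ε₀)
    (hV : ∀ (n : ℤ) (t : ℝ), t < 0 →
      HasDerivAt (V n) (bigLam ε₀ * V (n - 1) t ^ 2 - (bigLam ε₀)⁻¹ * (V n t * V (n + 1) t)) t)
    (hpos : ∀ (n : ℤ) (t : ℝ), t < 0 → 0 ≤ V n t)
    (hI : ∃ C : ℝ, ∀ (n : ℤ) (t : ℝ), t < 0 → V n t ≤ C / (-t))
    {M : ℝ} (hact : ∀ n : ℤ, IntegrableOn (fun t => |V n t|) (Iio 0) ∧ ∫ t in Iio 0, |V n t| ≤ M)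
    {v : ℤ → ℝ} (hv : ∀ n : ℤ, Tendsto (V n) (𝓝[<] 0) (𝓝 (v n)))
    (n : ℤ) {c : ℝ} (hc : ∀ t : ℝ, t < 0 → (-t) * V n t ≤ c) {τ : ℝ} (hτ : τ < 0) :
    v (n + 1) ≤ bigLam ε₀ * c ^ 2 / (-τ) + bigLam ε₀ * (Real.exp (M / bigLam ε₀) * v n) ^ 2 * (-τ) := by
  have hΛ : 0 < bigLam ε₀ := bigLam_pos (by linarith)
  set K : ℝ := Real.exp (M / bigLam ε₀) * v n with hKdef
  -- `V_{n+1}(τ) ≤ Λc²/(-τ)` by the squaring step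
  have hτb : V (n + 1) τ ≤ bigLam ε₀ * c ^ 2 / (-τ) := by
    have h := crit_succ_le_sq hε hV hpos hI n hc τ hτ
    have hnτ : 0 < -τ := by linarith
    rw [le_div_iff₀ hnτ, mul_comm]; exact h
  -- after `τ`: the plain ceiling `K`
  have hK : ∀ u : ℝ, τ ≤ u → u < 0 → V n u ≤ K := fun u _ hu => noOvershoot hε hV hpos hact hv n hu
  have hbound : ∀ s : ℝ, τ ≤ s → s < 0 →
      V (n + 1) s ≤ bigLam ε₀ * c ^ 2 / (-τ) + bigLam ε₀ * K ^ 2 * (-τ) := by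
    intro s hτs hs
    have h1 := succ_le_add_ceiling hε hV hpos n hK hτs hs
    have h2 : bigLam ε₀ * K ^ 2 * (s - τ) ≤ bigLam ε₀ * K ^ 2 * (-τ) := by
      have : s - τ ≤ -τ := by linarith
      have hK2 : 0 ≤ bigLam ε₀ * K ^ 2 := by positivity
      exact mul_le_mul_of_nonneg_left this hK2
    linarith
  refine le_of_tendsto (hv (n + 1)) ?_
  have hmem : Ico τ 0 ∈ 𝓝[<] (0 : ℝ) := Ico_mem_nhdsLT hτ
  filter_upwards [hmem] with s hs
  exact hbound s hs.1 hs.2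

/-- **THE TERMINAL RATIO THROUGH THE CRITICAL AMPLITUDE.**  If `(-t)·V_n(t) ≤ c` for all `t < 0`, then
`v_{n+1} ≤ 2Λ c · e^{M/Λ} v_n` (optimise `τ = -c/K` in `terminal_succ_le_window`; degenerate cases `c = 0` or `v_n = 0` by a
limit).  Companion of the tree's `terminal_succ_le` (`v_{n+1} ≤ ΛMe^{M/Λ}v_n`): the action `M` is replaced by twice the critical
amplitude of the shell.
[cite: Tao2016AveragedNS, §1.2, §4 Lemma 4.1 (4.8), §6.4; elementary] -/
theorem terminal_succ_le_crit (hε : 0 < ε₀)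
    (hV : ∀ (n : ℤ) (t : ℝ), t < 0 →
      HasDerivAt (V n) (bigLam ε₀ * V (n - 1) t ^ 2 - (bigLam ε₀)⁻¹ * (V n t * V (n + 1) t)) t)
    (hpos : ∀ (n : ℤ) (t : ℝ), t < 0 → 0 ≤ V n t)
    (hI : ∃ C : ℝ, ∀ (n : ℤ) (t : ℝ), t < 0 → V n t ≤ C / (-t))
    {M : ℝ} (hact : ∀ n : ℤ, IntegrableOn (fun t => |V n t|) (Iio 0) ∧ ∫ t in Iio 0, |V n t| ≤ M)
    {v : ℤ → ℝ} (hv : ∀ n : ℤ, Tendsto (V n) (𝓝[<] 0) (𝓝 (v n)))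
    (n : ℤ) {c : ℝ} (hc : ∀ t : ℝ, t < 0 → (-t) * V n t ≤ c) :
    v (n + 1) ≤ 2 * bigLam ε₀ * c * (Real.exp (M / bigLam ε₀) * v n) := by
  have hΛ : 0 < bigLam ε₀ := bigLam_pos (by linarith)
  set K : ℝ := Real.exp (M / bigLam ε₀) * v n with hKdef
  have hc0 : 0 ≤ c := by
    have h := hc (-1) (by norm_num)
    have h0 : 0 ≤ V n (-1) := hpos n (-1) (by norm_num)
    nlinarith
  have hK0 : 0 ≤ K := by
    have := terminal_nonneg hpos hv n
    rw [hKdef]; positivity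
  have hwin : ∀ τ : ℝ, τ < 0 → v (n + 1) ≤ bigLam ε₀ * c ^ 2 / (-τ) + bigLam ε₀ * K ^ 2 * (-τ) :=
    fun τ hτ => terminal_succ_le_window hε hV hpos hI hact hv n hc hτ
  rcases hc0.eq_or_lt with hc00 | hcpos
  · -- `c = 0`: `v_{n+1} ≤ ΛK²(-τ)` for all `τ < 0`; let `τ → 0⁻`
    rw [← hc00]
    have hgoal : v (n + 1) ≤ 0 := by
      refine le_of_forall_pos_lt_add fun δ hδ => ?_
      set τ : ℝ := -(δ / (bigLam ε₀ * K ^ 2 + 1)) with hτdef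
      have hden : 0 < bigLam ε₀ * K ^ 2 + 1 := by positivity
      have hτ : τ < 0 := by rw [hτdef]; exact neg_neg_of_pos (div_pos hδ hden)
      have h := hwin τ hτ
      rw [← hc00] at h
      have e1 : bigLam ε₀ * (0 : ℝ) ^ 2 / (-τ) = 0 := by simp
      have e2 : bigLam ε₀ * K ^ 2 * (-τ) < δ := by
        rw [hτdef, neg_neg]
        calc bigLam ε₀ * K ^ 2 * (δ / (bigLam ε₀ * K ^ 2 + 1))
            = δ * (bigLam ε₀ * K ^ 2 / (bigLam ε₀ * K ^ 2 + 1)) := by ring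
          _ < δ * 1 := by
              refine mul_lt_mul_of_pos_left ?_ hδ
              rw [div_lt_one hden]; linarith
          _ = δ := mul_one δ
      linarith
    simpa using hgoal
  rcases hK0.eq_or_lt with hK00 | hKpos
  · -- `K = 0`: `v_{n+1} ≤ Λc²/(-τ)` for all `τ < 0`; let `τ → -∞`
    rw [← hK00]
    have hgoal : v (n + 1) ≤ 0 := by
      refine le_of_forall_pos_lt_add fun δ hδ => ?_
      set τ : ℝ := -(bigLam ε₀ * c ^ 2 / δ + 1) with hτdef
      have hnτ : 0 < -τ := by
        rw [hτdef, neg_neg]; positivity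
      have hτ : τ < 0 := by linarith
      have h := hwin τ hτ
      rw [← hK00] at h
      have e2 : bigLam ε₀ * c ^ 2 / (-τ) < δ := by
        rw [div_lt_iff₀ hnτ, hτdef, neg_neg, mul_add, mul_div_cancel₀ _ hδ.ne', mul_one]
        linarith [mul_pos hΛ (pow_pos hcpos 2)]
      have e3 : bigLam ε₀ * (0 : ℝ) ^ 2 * (-τ) = 0 := by simp
      linarith
    simpa using hgoal
  · -- `c > 0`, `K > 0`: `τ = -c/K`
    have hτ : -(c / K) < 0 := neg_neg_of_pos (div_pos hcpos hKpos)
    have h := hwin (-(c / K)) hτ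
    rw [neg_neg] at h
    have e : bigLam ε₀ * c ^ 2 / (c / K) + bigLam ε₀ * K ^ 2 * (c / K) = 2 * bigLam ε₀ * c * K := by
      field_simp
      ring
    linarith

end Summit.NavierStokesRegularity.NavierStokesRegularity.Theorems.NoSurvivingEternalViscBddOne.DyadicCriticalSquaring

end
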